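import Summits.QuantumFields.YangMills.Theorems.BalabanUVNodesN15TwoSpacingGluingAveraging
import Literature.MathematicalPhysics.QuantumFieldTheory.Balaban1983to89.B11B3
import HarnessLib

/-!
# THE GLUING STEP AT TWO LATTICE SPACINGS, XIV: the commutator of a NONLOCAL exponentially decaying operator with a slowly varying partition function — [B5] (1.120)'s `P(dh) = [∂P∂*, h]`,
# kernel `(h(x) − h(x′))·N(x, x′)` — is small: `[N, M_h] ≤ (ℓ∕(eε) + 2ω)·c_N·e^{−(δ−ε)d}` from `N ≤ c_N e^{−δd}`, the block-Lipschitz constant `ℓ` and the block oscillation `ω` of `h` (both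
# `O(M⁻¹)` for the gluing's partition) — EXACTLY at block resolution for block-constant `h`, for operators between two carriers (so the same lemma serves the two-grid defect
# `𝔇(N′, N)`) (dag-n15-c g11, FILE 56; N15 = NE2, s1 «background-layer OPERATOR ingredient»; generic)

Cell `pub-ymgap`, seat `pub-ymgap-dag-n15-c` (R134 (a); HUMAN RULING D-0062), generation 11.  `bears_on: R4∕N15 · K3⁷ SpineGivenEndpointR13SepCoPH (stmt-QuantumFields-20544)`.
Filed `--supports stmt-QuantumFields-20544 --as helper` — COUNT-NEUTRAL.  Theorems only (0 `def`, 0 `sorry`).  Imports BY NAME FILE 51 `…N15TwoSpacingGluingAveraging` (`mulOp_add`; FILE 45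
`commOp`, `hasMaj_diag_comp`, `hasMaj_comp_diag`) and `Literature…B11B3` (`mul_exp_neg_le`: `t·e^{−st} ≤ 1∕(es)`); B11 `abs_le_loc_ofBlocks`, `loc_ofBlocks_le`; nothing in the tree is
modified.

WHY.  FILE 45's remainder `R = −Σ_□ [Δ_a, M_{h_□}]G_□M_{h_□}` needs the commutator rows `[Δ_a, M_{h_□}]∘G_□` SMALL (`θ₀ = O(M⁻¹)`).  For the LOCAL part of `Δ_a` this is FILE 46∕52
(lattice Leibniz, two-sided localized rows).  But Bałaban's `Δ_a = Δ − ∂P∂* + aQ*Q` carries the NONLOCAL Landau term `∂P∂*`, and [B5] (1.120)–(1.121) p.37 print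
`Δ_a h = hΔ_a − K(h)`, `K(h)` = local first-order terms `+ P(dh)`, `P(dh) := [∂P∂*, h]` with kernel `(h(x) − h(x′))(∂P∂*)(x, x′)`; p.38: «The operator K(h) is a simple, short-ranged,
first order differential operator, except the term P(dh)» — bounded through (1.126) `|(∂P∂*)(x,x′)| ≤ O(1)e^{−δ′|x−x′|}` with «a small factor O(M⁻¹) and the exponential factor» (1.128)
(dag-n15-a g19 l.27702 met exactly this: «with a NONLOCAL Δ_a the commutator letter cannot be output-localized»).  THIS FILE types the mechanism at block resolution, for ANY
`T : (X → ℝ) →ₗ (X′ → ℝ)` with a block majorant `K` between block maps `blk`, `blk′` (two carriers, so that `T = 𝔇(N′, N)` is covered): ★★ `hasMaj_comm_blockConst` — for a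
block-CONSTANT `hb`, `T∘M_{hb∘blk} − M_{hb∘blk′}∘T ≤ |hb(y′) − hb(y)|·K(y, y′)` EXACTLY (on an input localized in block `y′`, `M_{hb∘blk}` IS the scalar `hb(y′)`); ★
`hasMaj_comm_blockLipschitz` — `|hb(y) − hb(y′)| ≤ ℓ·d(y,y′)`, `K = c·e^{−δd}` ⟹ `≤ ℓ(eε)⁻¹c·e^{−(δ−ε)d}` (`d·e^{−εd} ≤ (eε)⁻¹`); ★ `hasMaj_comm_oscillation` — `|a|, |a′| ≤ ω` ⟹
`T∘M_a − M_{a′}∘T ≤ 2ωK`; ★★ `hasMaj_comm_nonlocal` — `|h − hb∘blk|, |h′ − hb∘blk′| ≤ ω` ⟹ `T∘M_h − M_{h′}∘T ≤ (ℓ(eε)⁻¹ + 2ω)c·e^{−(δ−ε)d}`; ★★ `hasMaj_commOp_nonlocal` — the one-carrier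
reading `[N, M_h] ≤ (ℓ(eε)⁻¹ + 2ω)c_N·e^{−(δ−ε)d}` = (1.128)'s shape with `ℓ, ω = O(M⁻¹)` displayed; ★★ `hasMaj_idef_commOp_nonlocal` — its η-defect
`𝔇([N′, M_{h′}], [N, M_h]) ≤ ((ℓ(eε)⁻¹ + 2ω)·r_N + 2o·c)·e^{−(δ−ε)d}` through the two-carrier lemma at `T = 𝔇(N′, N) ≤ r_N e^{−δd}` and the fit `|h′ − h∘π| ≤ o`.

HONEST FRAMING ∕ LIMITS.  Block-majorant bookkeeping; [B5] (1.120)–(1.121) p.37, (1.126)–(1.128) p.38 = SHAPES ∕ MECHANISM; the decay (1.126) of `∂P∂*` itself is NOT proved here (it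
stays the displayed letter `c, δ` of `N`); nothing of [B5]∕[B6]∕[B9] asserted.  NE2⁺ NOT PRINTED, NOT proved; N15 NOT discharged; counts of record UNMOVED (typed 28∕28 · discharged 5∕27);
one finite 𝕋⁴ at fixed ε — NOT infinite volume, NOT OS on ℝ⁴, NOT a mass gap, NOT Clay; R4 closes the conditional finite-𝕋⁴ rung `BalabanLadder.UV` only.  Restate-immune.
-/

noncomputable section

namespace Summit.QuantumFields.YangMills.BalabanUVNodes.N15.Gluing

open Literature.MathematicalPhysics.QuantumFieldTheory.Balaban1983to89
open Literature.MathematicalPhysics.QuantumFieldTheory.Balaban1983to89.B11SectG (BlockNorm HasMaj)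
open Literature.MathematicalPhysics.QuantumFieldTheory.Balaban1983to89.B11AxialTransport190 (abs_le_loc_ofBlocks loc_ofBlocks_le)
open Literature.MathematicalPhysics.QuantumFieldTheory.Balaban1983to89.T4EtaRateDefect (idef idef_sub idef_comp)
open Literature.MathematicalPhysics.QuantumFieldTheory.Balaban1983to89.T4EtaRateCoeffDefect (pull diagK hasMaj_mulOp hasMaj_idef_mulOp)
open Literature.MathematicalPhysics.QuantumFieldTheory.Balaban1983to89.B6Prop26Gluing (mulOp mulOp_apply)

section TwoCarrier

variable {X X' : Type} [Fintype X] [Fintype X'] {g : B6.Geometry} (blk : X → g.Site) (blk' : X' → g.Site)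

/-- ★★ **THE BLOCK-CONSTANT COMMUTATOR, EXACT AT BLOCK RESOLUTION** ([B5] (1.120)'s kernel `(h(x) − h(x′))N(x,x′)`): for a block-constant `hb` and ANY `T` with block majorant `K`,
`T∘M_{hb∘blk} − M_{hb∘blk′}∘T ≤ |hb(y′) − hb(y)|·K(y, y′)` — on an input localized in block `y′`, `M_{hb∘blk}` acts as the scalar `hb(y′)`, and on the output block `y`, `M_{hb∘blk′}` as
`hb(y)`. [cite: Balaban1984PropagatorsI, (1.120) p.37 (shape + mechanism)] -/
theorem hasMaj_comm_blockConst {T : (X → ℝ) →ₗ[ℝ] (X' → ℝ)} {K : g.Site → g.Site → ℝ} (hT : HasMaj (BlockNorm.ofBlocks g blk) (BlockNorm.ofBlocks g blk') T K) (hb : g.Site → ℝ) :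
    HasMaj (BlockNorm.ofBlocks g blk) (BlockNorm.ofBlocks g blk') (T ∘ₗ mulOp (hb ∘ blk) - mulOp (hb ∘ blk') ∘ₗ T) (fun y y' => |hb y' - hb y| * K y y') := by
  intro y' μ hμ y
  have hμ' : ∀ x : X, blk x ≠ y' → μ x = 0 := hμ
  have hM : mulOp (hb ∘ blk) μ = hb y' • μ := by
    funext x
    rw [mulOp_apply, Pi.smul_apply, smul_eq_mul, Function.comp_apply]
    by_cases hx : blk x = y'
    · rw [hx]
    · rw [hμ' x hx, mul_zero, mul_zero]
  have hTμ := hT y' μ hμ y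
  have hK : 0 ≤ K y y' * (BlockNorm.ofBlocks g blk).loc y' μ := ((BlockNorm.ofBlocks g blk').loc_nonneg _ _).trans hTμ
  refine loc_ofBlocks_le blk' _ (by rw [mul_assoc]; exact mul_nonneg (abs_nonneg _) hK) fun x' hx' => ?_
  rw [LinearMap.sub_apply, LinearMap.comp_apply, LinearMap.comp_apply, hM, map_smul, Pi.sub_apply, Pi.smul_apply, smul_eq_mul, mulOp_apply, Function.comp_apply, hx',
    ← sub_mul, abs_mul, mul_assoc]
  exact mul_le_mul_of_nonneg_left ((abs_le_loc_ofBlocks blk' (T μ) hx').trans hTμ) (abs_nonneg _)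

omit [Fintype X] [Fintype X'] in
/-- `d·e^{−δd} ≤ (eε)⁻¹·e^{−(δ−ε)d}` for `ε > 0` (from `t·e^{−εt} ≤ 1∕(eε)`). [folklore] -/
theorem dist_mul_exp_le {ε δ t : ℝ} (hε : 0 < ε) : t * Real.exp (-(δ * t)) ≤ (Real.exp 1 * ε)⁻¹ * Real.exp (-((δ - ε) * t)) := by
  have h := B11B3.mul_exp_neg_le hε t
  have hsplit : Real.exp (-(δ * t)) = Real.exp (-(ε * t)) * Real.exp (-((δ - ε) * t)) := by rw [← Real.exp_add]; ring_nf
  rw [hsplit, ← mul_assoc, one_div] at *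
  exact mul_le_mul_of_nonneg_right h (Real.exp_nonneg _)

/-- ★ **THE LIPSCHITZ READING** («a small factor O(M⁻¹) and the exponential factor», (1.128)): `|hb(y) − hb(y′)| ≤ ℓ·d(y,y′)` and `T ≤ c·e^{−δd}` ⟹
`T∘M_{hb∘blk} − M_{hb∘blk′}∘T ≤ ℓ(eε)⁻¹c·e^{−(δ−ε)d}` for every `ε > 0`. [cite: Balaban1984PropagatorsI, (1.126)–(1.128) p.38 (mechanism)] -/
theorem hasMaj_comm_blockLipschitz {T : (X → ℝ) →ₗ[ℝ] (X' → ℝ)} {c δ ℓ ε : ℝ} {hb : g.Site → ℝ} (hc : 0 ≤ c) (hℓ : 0 ≤ ℓ) (hε : 0 < ε)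
    (hLip : ∀ y y', |hb y - hb y'| ≤ ℓ * g.dist y y') (hsymm : ∀ y y', g.dist y y' = g.dist y' y)
    (hT : HasMaj (BlockNorm.ofBlocks g blk) (BlockNorm.ofBlocks g blk') T (fun y y' => c * Real.exp (-(δ * g.dist y y')))) :
    HasMaj (BlockNorm.ofBlocks g blk) (BlockNorm.ofBlocks g blk') (T ∘ₗ mulOp (hb ∘ blk) - mulOp (hb ∘ blk') ∘ₗ T)
      (fun y y' => ℓ * (Real.exp 1 * ε)⁻¹ * c * Real.exp (-((δ - ε) * g.dist y y'))) := by
  refine (hasMaj_comm_blockConst blk blk' hT hb).mono fun y y' => ?_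
  have h1 : |hb y' - hb y| ≤ ℓ * g.dist y y' := (hLip y' y).trans (by rw [hsymm])
  have h2 := dist_mul_exp_le (δ := δ) (t := g.dist y y') hε
  calc |hb y' - hb y| * (c * Real.exp (-(δ * g.dist y y'))) ≤ ℓ * g.dist y y' * (c * Real.exp (-(δ * g.dist y y'))) :=
        mul_le_mul_of_nonneg_right h1 (mul_nonneg hc (Real.exp_nonneg _))
    _ = ℓ * c * (g.dist y y' * Real.exp (-(δ * g.dist y y'))) := by ring
    _ ≤ ℓ * c * ((Real.exp 1 * ε)⁻¹ * Real.exp (-((δ - ε) * g.dist y y'))) := mul_le_mul_of_nonneg_left h2 (mul_nonneg hℓ hc)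
    _ = _ := by ring

/-- ★ **THE OSCILLATION PART**: `|a| ≤ ω` on `X`, `|a′| ≤ ω` on `X′`, `T ≤ K` (`K ≥ 0`) ⟹ `T∘M_a − M_{a′}∘T ≤ 2ω·K`. [folklore] -/
theorem hasMaj_comm_oscillation {T : (X → ℝ) →ₗ[ℝ] (X' → ℝ)} {K : g.Site → g.Site → ℝ} {a : X → ℝ} {a' : X' → ℝ} {ω : ℝ} (hω : 0 ≤ ω) (hK : ∀ y y', 0 ≤ K y y')
    (ha : ∀ x, |a x| ≤ ω) (ha' : ∀ x', |a' x'| ≤ ω) (hT : HasMaj (BlockNorm.ofBlocks g blk) (BlockNorm.ofBlocks g blk') T K) :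
    HasMaj (BlockNorm.ofBlocks g blk) (BlockNorm.ofBlocks g blk') (T ∘ₗ mulOp a - mulOp a' ∘ₗ T) (fun y y' => 2 * ω * K y y') := by
  have t1 := hasMaj_comp_diag blk hK hT (hasMaj_mulOp (g := g) blk (m := fun _ => ω) (fun _ => hω) ha)
  have t2 := hasMaj_diag_comp blk' (fun _ => hω) (hasMaj_mulOp (g := g) blk' (m := fun _ => ω) (fun _ => hω) ha') hT
  refine (t1.sub t2).mono fun y y' => le_of_eq ?_
  ring

/-- ★★ **THE NONLOCAL COMMUTATOR LETTER, two carriers**: `h = hb∘blk + r`, `h′ = hb∘blk′ + r′` with `|r|, |r′| ≤ ω`, `|hb(y) − hb(y′)| ≤ ℓd(y,y′)`, `T ≤ c·e^{−δd}`, `d ≥ 0` symmetric, `ε > 0`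
⟹ `T∘M_h − M_{h′}∘T ≤ (ℓ(eε)⁻¹ + 2ω)·c·e^{−(δ−ε)d}` — for `T = 𝔇(N′, N)` this is the two-grid row of [B5]'s `P(dh)`. [cite: Balaban1984PropagatorsI, (1.120) p.37, (1.126)–(1.128) p.38 (shape + mechanism)] -/
theorem hasMaj_comm_nonlocal {T : (X → ℝ) →ₗ[ℝ] (X' → ℝ)} {c δ ℓ ω ε : ℝ} {hb : g.Site → ℝ} {h : X → ℝ} {h' : X' → ℝ} (hc : 0 ≤ c) (hℓ : 0 ≤ ℓ) (hω : 0 ≤ ω) (hε : 0 < ε)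
    (hd : ∀ y y', 0 ≤ g.dist y y') (hsymm : ∀ y y', g.dist y y' = g.dist y' y) (hLip : ∀ y y', |hb y - hb y'| ≤ ℓ * g.dist y y')
    (hr : ∀ x, |h x - hb (blk x)| ≤ ω) (hr' : ∀ x', |h' x' - hb (blk' x')| ≤ ω)
    (hT : HasMaj (BlockNorm.ofBlocks g blk) (BlockNorm.ofBlocks g blk') T (fun y y' => c * Real.exp (-(δ * g.dist y y')))) :
    HasMaj (BlockNorm.ofBlocks g blk) (BlockNorm.ofBlocks g blk') (T ∘ₗ mulOp h - mulOp h' ∘ₗ T)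
      (fun y y' => (ℓ * (Real.exp 1 * ε)⁻¹ + 2 * ω) * c * Real.exp (-((δ - ε) * g.dist y y'))) := by
  have hsplit : T ∘ₗ mulOp h - mulOp h' ∘ₗ T =
      (T ∘ₗ mulOp (hb ∘ blk) - mulOp (hb ∘ blk') ∘ₗ T) + (T ∘ₗ mulOp (h - hb ∘ blk) - mulOp (h' - hb ∘ blk') ∘ₗ T) := by
    have e1 : mulOp h = mulOp (hb ∘ blk) + mulOp (h - hb ∘ blk) := by rw [← mulOp_add]; congr 1; abel
    have e2 : mulOp h' = mulOp (hb ∘ blk') + mulOp (h' - hb ∘ blk') := by rw [← mulOp_add]; congr 1; abel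
    rw [e1, e2, LinearMap.comp_add, LinearMap.add_comp]
    abel
  have t1 := hasMaj_comm_blockLipschitz blk blk' hc hℓ hε hLip hsymm hT
  have t2 := hasMaj_comm_oscillation blk blk' (a := h - hb ∘ blk) (a' := h' - hb ∘ blk') hω (fun y y' => mul_nonneg hc (Real.exp_nonneg _))
    (fun x => hr x) (fun x' => hr' x') hT
  rw [hsplit]
  refine (t1.add t2).mono fun y y' => ?_
  have hexp : Real.exp (-(δ * g.dist y y')) ≤ Real.exp (-((δ - ε) * g.dist y y')) :=
    Real.exp_le_exp.2 (by nlinarith [hd y y', hε.le])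
  have h2 : 2 * ω * (c * Real.exp (-(δ * g.dist y y'))) ≤ 2 * ω * (c * Real.exp (-((δ - ε) * g.dist y y'))) :=
    mul_le_mul_of_nonneg_left (mul_le_mul_of_nonneg_left hexp hc) (by positivity)
  calc ℓ * (Real.exp 1 * ε)⁻¹ * c * Real.exp (-((δ - ε) * g.dist y y')) + 2 * ω * (c * Real.exp (-(δ * g.dist y y')))
      ≤ ℓ * (Real.exp 1 * ε)⁻¹ * c * Real.exp (-((δ - ε) * g.dist y y')) + 2 * ω * (c * Real.exp (-((δ - ε) * g.dist y y'))) := by linarith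
    _ = _ := by ring

end TwoCarrier

section OneCarrier

variable {X : Type} [Fintype X] {g : B6.Geometry} (blk : X → g.Site)

/-- ★★ **[B5]'s `P(dh) = [∂P∂*, h]` AT BLOCK RESOLUTION**: a nonlocal `N ≤ c_N·e^{−δd}` and a partition function `h` with block-Lipschitz constant `ℓ` and block oscillation `ω` (both `O(M⁻¹)`
for the gluing's `h_□`) ⟹ `[N, M_h] ≤ (ℓ(eε)⁻¹ + 2ω)·c_N·e^{−(δ−ε)d}`, every `ε > 0` — «a small factor O(M⁻¹) and the exponential factor». [cite: Balaban1984PropagatorsI, (1.120)–(1.121) p.37, (1.128) p.38] -/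
theorem hasMaj_commOp_nonlocal {N : (X → ℝ) →ₗ[ℝ] (X → ℝ)} {c δ ℓ ω ε : ℝ} {hb : g.Site → ℝ} {h : X → ℝ} (hc : 0 ≤ c) (hℓ : 0 ≤ ℓ) (hω : 0 ≤ ω) (hε : 0 < ε)
    (hd : ∀ y y', 0 ≤ g.dist y y') (hsymm : ∀ y y', g.dist y y' = g.dist y' y) (hLip : ∀ y y', |hb y - hb y'| ≤ ℓ * g.dist y y') (hr : ∀ x, |h x - hb (blk x)| ≤ ω)
    (hN : HasMaj (BlockNorm.ofBlocks g blk) (BlockNorm.ofBlocks g blk) N (fun y y' => c * Real.exp (-(δ * g.dist y y')))) :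
    HasMaj (BlockNorm.ofBlocks g blk) (BlockNorm.ofBlocks g blk) (commOp N h) (fun y y' => (ℓ * (Real.exp 1 * ε)⁻¹ + 2 * ω) * c * Real.exp (-((δ - ε) * g.dist y y'))) :=
  hasMaj_comm_nonlocal blk blk hc hℓ hω hε hd hsymm hLip hr hr hN

end OneCarrier

/-! ## The two-grid defect of the nonlocal commutator -/

section Defect

variable {X X' : Type} [Fintype X] [Fintype X'] {g : B6.Geometry} (blk : X → g.Site) (π : X' → X)

/-- ★★ **THE η-DEFECT OF `P(dh)`**: `𝔇([N′, M_{h′}], [N, M_h]) = (𝔇(N′,N)∘M_h − M_{h′}∘𝔇(N′,N)) + (N′∘𝔇(M_{h′},M_h) − 𝔇(M_{h′},M_h)∘N)` — the first bracket is the two-carrier nonlocal commutator of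
the defect operator `𝔇(N′, N) ≤ r_N·e^{−δd}` (★★ `hasMaj_comm_nonlocal`), the second is the fit `|h′ − h∘π| ≤ o` against `N, N′ ≤ c·e^{−δd}`:
`≤ ((ℓ(eε)⁻¹ + 2ω)·r_N + 2o·c)·e^{−(δ−ε)d}`. [cite: Balaban1984PropagatorsI, (1.120) p.37, (1.128) p.38 (shape); Balaban1985BackgroundPropagators, Thm 3.14 pp.426–427 (difference template)] -/
theorem hasMaj_idef_commOp_nonlocal {N : (X → ℝ) →ₗ[ℝ] (X → ℝ)} {N' : (X' → ℝ) →ₗ[ℝ] (X' → ℝ)} {c rN δ ℓ ω o ε : ℝ} {hb : g.Site → ℝ} {h : X → ℝ} {h' : X' → ℝ}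
    (hc : 0 ≤ c) (hrN : 0 ≤ rN) (hℓ : 0 ≤ ℓ) (hω : 0 ≤ ω) (ho : 0 ≤ o) (hε : 0 < ε) (hd : ∀ y y', 0 ≤ g.dist y y') (hsymm : ∀ y y', g.dist y y' = g.dist y' y)
    (hLip : ∀ y y', |hb y - hb y'| ≤ ℓ * g.dist y y') (hr : ∀ x, |h x - hb (blk x)| ≤ ω) (hr' : ∀ x', |h' x' - hb (blk (π x'))| ≤ ω) (hfit : ∀ x', |h' x' - h (π x')| ≤ o)
    (hN : HasMaj (BlockNorm.ofBlocks g blk) (BlockNorm.ofBlocks g blk) N (fun y y' => c * Real.exp (-(δ * g.dist y y'))))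
    (hN' : HasMaj (BlockNorm.ofBlocks g (blk ∘ π)) (BlockNorm.ofBlocks g (blk ∘ π)) N' (fun y y' => c * Real.exp (-(δ * g.dist y y'))))
    (hDN : HasMaj (BlockNorm.ofBlocks g blk) (BlockNorm.ofBlocks g (blk ∘ π)) (idef (pull π) (pull π) N' N) (fun y y' => rN * Real.exp (-(δ * g.dist y y')))) :
    HasMaj (BlockNorm.ofBlocks g blk) (BlockNorm.ofBlocks g (blk ∘ π)) (idef (pull π) (pull π) (commOp N' h') (commOp N h))
      (fun y y' => ((ℓ * (Real.exp 1 * ε)⁻¹ + 2 * ω) * rN + 2 * o * c) * Real.exp (-((δ - ε) * g.dist y y'))) := by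
  have hsplit : idef (pull π) (pull π) (commOp N' h') (commOp N h) =
      (idef (pull π) (pull π) N' N ∘ₗ mulOp h - mulOp h' ∘ₗ idef (pull π) (pull π) N' N) +
        (N' ∘ₗ idef (pull π) (pull π) (mulOp h') (mulOp h) - idef (pull π) (pull π) (mulOp h') (mulOp h) ∘ₗ N) := by
    rw [commOp, commOp, idef_sub, idef_comp (pull π) (pull π) (pull π), idef_comp (pull π) (pull π) (pull π)]
    abel
  have hDM := hasMaj_idef_mulOp (g := g) blk π (o := fun _ => o) (fun _ => ho) hfit
  have hKnn : ∀ y y' : g.Site, 0 ≤ c * Real.exp (-(δ * g.dist y y')) := fun y y' => mul_nonneg hc (Real.exp_nonneg _)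
  have t1 := hasMaj_comm_nonlocal blk (blk ∘ π) (h := h) (h' := h') hrN hℓ hω hε hd hsymm hLip hr (fun x' => hr' x') hDN
  have t2 := hasMaj_comp_diag (blk ∘ π) hKnn hN' hDM
  have t3 := hasMaj_diag_comp blk (fun _ => ho) hDM hN
  rw [hsplit]
  refine (t1.add (t2.sub t3)).mono fun y y' => ?_
  have hexp : Real.exp (-(δ * g.dist y y')) ≤ Real.exp (-((δ - ε) * g.dist y y')) := Real.exp_le_exp.2 (by nlinarith [hd y y', hε.le])
  have h2 : c * Real.exp (-(δ * g.dist y y')) * o + o * (c * Real.exp (-(δ * g.dist y y'))) ≤ 2 * o * c * Real.exp (-((δ - ε) * g.dist y y')) := by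
    nlinarith [mul_le_mul_of_nonneg_left hexp (mul_nonneg ho hc)]
  calc (ℓ * (Real.exp 1 * ε)⁻¹ + 2 * ω) * rN * Real.exp (-((δ - ε) * g.dist y y')) + (c * Real.exp (-(δ * g.dist y y')) * o + o * (c * Real.exp (-(δ * g.dist y y'))))
      ≤ (ℓ * (Real.exp 1 * ε)⁻¹ + 2 * ω) * rN * Real.exp (-((δ - ε) * g.dist y y')) + 2 * o * c * Real.exp (-((δ - ε) * g.dist y y')) := by linarith
    _ = _ := by ring

end Defect

end Summit.QuantumFields.YangMills.BalabanUVNodes.N15.Gluing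

end
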